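import Mathlib
import Summits.Ventures.PercRepro2.TwoHullMasterBlocksRigid

/-!
# The cube-cover conjecture (blind cell PercRepro2, night-4 g40, 2026-08-29; proofs/NIGHT4-G40.md §9)

THE CONJECTURE: for every finite graph and every two marks `l ≠ h`, the configurations with no
monochromatic `l`–`h` connection are a disjoint union of monotone cube blocks (`CubeCover`,
TwoHullMasterBlocks.lean) — and likewise of rigid ones (`CubeCoverRigid`).  Census (own code,
mining/night-4/g40/symcover2.py, kit j333295): σ-symmetric covers with at most four edge classes
exist for every ordered pair of marks of every connected graph with `n ≤ 6` vertices (3,360 cases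
at `n = 6`, 420 at `n = 5`, 84 at `n = 4`); kernel certificates: the prism and the subdivided prism
(TwoHullMasterPrism.lean, TwoHullMasterPrismSub.lean, TwoHullMasterPrismRigid.lean).  The
conjecture implies (MM) on every graph (`twoHullMaster_all_of_cubeCoverConjecture`), hence row
(SW) (`sw_all_of_twoHullMaster_all`), and its rigid form implies row 2′SW-ALL
(`swAll_all_of_twoHullMasterRigid_all`).  What a proof needs is a CANONICAL choice of the edge
classes; on paths the finest classes at a bottom are «the two edges across every B→R colour
change merged, every other edge alone» (NIGHT4-G40.md §9).
-/

namespace Summit.Ventures.PercRepro2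

namespace Blocks

open Hull LocRows

/-- **The cube-cover conjecture**: `U` has a cube cover on every finite graph, for every pair of
marks. -/
def CubeCoverConjecture : Prop :=
  ∀ (V E : Type) [Fintype V] [DecidableEq V] [Fintype E] [DecidableEq E] (ends : E → Sym2 V)
    (l h : V), l ≠ h →
      ∃ (β : Type) (_ : Fintype β) (ι : β → Type) (_ : ∀ b, Fintype (ι b))
        (pt : ∀ b, (ι b → Bool) → Config E), CubeCover ends l h pt

/-- **The rigid cube-cover conjecture.** -/
def CubeCoverRigidConjecture : Prop :=
  ∀ (V E : Type) [Fintype V] [DecidableEq V] [Fintype E] [DecidableEq E] (ends : E → Sym2 V)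
    (l h : V), l ≠ h →
      ∃ (β : Type) (_ : Fintype β) (ι : β → Type) (_ : ∀ b, Fintype (ι b))
        (pt : ∀ b, (ι b → Bool) → Config E), CubeCoverRigid ends l h pt

/-- The cube-cover conjecture gives (MM) on every graph. -/
theorem twoHullMaster_all_of_cubeCoverConjecture (hc : CubeCoverConjecture) :
    TwoHullMaster_all := by
  intro V E _ _ _ _ ends l h hlh
  obtain ⟨β, _, ι, _, pt, hcov⟩ := hc V E ends l h hlh
  exact twoHullMaster_of_cubeCover hcov

/-- The rigid cube-cover conjecture gives the rigid (MM) on every graph. -/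
theorem twoHullMasterRigid_all_of_cubeCoverRigidConjecture (hc : CubeCoverRigidConjecture) :
    TwoHullMasterRigid_all := by
  intro V E _ _ _ _ ends l h hlh
  obtain ⟨β, _, ι, _, pt, hcov⟩ := hc V E ends l h hlh
  exact twoHullMasterRigid_of_cubeCoverRigid hcov

/-- The cube-cover conjecture gives row (SW) on every graph. -/
theorem sw_all_of_cubeCoverConjecture (hc : CubeCoverConjecture) : Sw_all :=
  sw_all_of_twoHullMaster_all (twoHullMaster_all_of_cubeCoverConjecture hc)

/-- The rigid cube-cover conjecture gives row 2′SW-ALL on every graph. -/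
theorem swAll_all_of_cubeCoverRigidConjecture (hc : CubeCoverRigidConjecture) : SwAll_all :=
  swAll_all_of_twoHullMasterRigid_all (twoHullMasterRigid_all_of_cubeCoverRigidConjecture hc)

end Blocks

end Summit.Ventures.PercRepro2
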